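import Literature.MathematicalPhysics.QuantumLattice.NarrowWellPlaquetteAction
import Literature.MathematicalPhysics.QuantumLattice.SU2Haar
import Literature.MathematicalPhysics.QuantumFieldTheory.PlaquetteWeightSiteRP
import Literature.RepresentationTheory.CompactGroups.UnitaryTrick
import HarnessLib

/-!
# Reflection positivity (through sites) of the narrow-well lattice gauge model on `SU(2)`

Fourth layer under the named fact
`Literature.MathematicalPhysics.QuantumLattice.enterShlosman_narrowWell_firstOrderTransition`
(van Enter–Shlosman 2005, Thm. 2): the narrow-well plaquette weight
`NarrowWell.weight p g = ((1 + ½ Re tr g)/2)^p` is a continuous inversion-invariant class function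
on `SU(2)` (`weight_conj`, `weight_inv`), so the general site-reflection-positivity theorem
`QuantumFieldTheory.integral_conj_negReflect_mul_exp_nonneg` (`PlaquetteWeightSiteRP`) applies:
for every even torus `(ℤ/Lℤ)^d`, every real coupling `J` and every bounded measurable observable `F`
of the closed positive-time half,
`0 ≤ ∫ conj F(Θ'U) F(U) exp(J Σ_q weight p (U_q)) d(⊗ Haar)`
(`integral_conj_negReflect_mul_exp_weight_nonneg`) — the reflection positivity "in planes passing
through sites" invoked by van Enter–Shlosman (p. 3, contour estimates "by Reflection Positivity")
for the time direction. Everything is proved; no facts.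

## References

* A. C. D. van Enter, S. B. Shlosman, Comm. Math. Phys. 255 (2005) 21–32, Thm. 2
  [VanEnterShlosman2005].
* J. Fröhlich, R. Israel, E. H. Lieb, B. Simon, Comm. Math. Phys. 62 (1978) 1–34, Thm. 2.1
  [FrohlichIsraelLiebSimon1978].
-/

noncomputable section

open _root_.MeasureTheory
open scoped ComplexConjugate ComplexOrder

namespace Literature.MathematicalPhysics.QuantumLattice

open Literature.MathematicalPhysics.QuantumFieldTheory
open Literature.RepresentationTheory.CompactGroups

namespace NarrowWell

/-- The narrow-well weight is a class function: `weight p (h g h⁻¹) = weight p g`. [folklore] -/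
theorem weight_conj (p : ℕ) (g h : Matrix.specialUnitaryGroup (Fin 2) ℂ) :
    weight p (h * g * h⁻¹) = weight p g := by
  have htr : ((h * g * h⁻¹ : Matrix.specialUnitaryGroup (Fin 2) ℂ) : Matrix (Fin 2) (Fin 2) ℂ).trace =
      (g : Matrix (Fin 2) (Fin 2) ℂ).trace := by
    rw [← fundamentalRep_apply, ← fundamentalRep_apply, CompactGroup.trace_conj_eq]
  rw [weight, weight, htr]

/-- The narrow-well weight is inversion invariant: `weight p g⁻¹ = weight p g`. [folklore] -/
theorem weight_inv (p : ℕ) (g : Matrix.specialUnitaryGroup (Fin 2) ℂ) :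
    weight p g⁻¹ = weight p g := by
  have htr : (((g⁻¹ : Matrix.specialUnitaryGroup (Fin 2) ℂ) : Matrix (Fin 2) (Fin 2) ℂ).trace).re =
      ((g : Matrix (Fin 2) (Fin 2) ℂ).trace).re := by
    rw [← fundamentalRep_apply, ← fundamentalRep_apply,
      CompactGroup.re_trace_map_inv _ (continuous_fundamentalRep (Fin 2))]
  rw [weight, weight, htr]

/-- **Site-reflection positivity of the narrow-well gauge model** (time hyperplanes `t = 0`,
`t = L/2`; even `L`; every real coupling `J`; every non-linearity `p`): for every bounded
measurable observable `F` depending only on the links of the closed positive-time half,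
`0 ≤ ∫ conj F(Θ'U) · F(U) · exp(J Σ_q weight p (U_q)) d(⊗_e Haar)(U)`.
[cite: VanEnterShlosman2005, p. 3 (contour estimates "by Reflection Positivity"), with FrohlichIsraelLiebSimon1978 Thm. 2.1] -/
theorem integral_conj_negReflect_mul_exp_weight_nonneg {d L : ℕ} [NeZero d] [NeZero L]
    (hL : Even L) (p : ℕ) (J : ℝ)
    (F : GaugeConfig d L (Matrix.specialUnitaryGroup (Fin 2) ℂ) → ℂ) (hF : Measurable F)
    (hFb : ∃ C : ℝ, ∀ U, ‖F U‖ ≤ C)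
    (hFdep : DependsOn F ((WilsonSiteRP.sitePosEdges ∪ WilsonSiteRP.sharedEdges :
      Finset (Edge d L)) : Set (Edge d L))) :
    0 ≤ ∫ U : GaugeConfig d L (Matrix.specialUnitaryGroup (Fin 2) ℂ), conj (F U.negReflect) * F U *
        (Real.exp (J * ∑ q : Plaquette d L, weight p (plaquetteHolonomy U q.1 q.2.1.1 q.2.1.2)) : ℂ)
      ∂(Measure.pi fun _ : Edge d L => haarProbability (Matrix.specialUnitaryGroup (Fin 2) ℂ)) := by
  haveI : SecondCountableTopology (Matrix.specialUnitaryGroup (Fin 2) ℂ) :=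
    secondCountableTopology_su2
  exact integral_conj_negReflect_mul_exp_nonneg hL (continuous_weight p) (weight_conj p)
    (weight_inv p) J F hF hFb hFdep

end NarrowWell

end Literature.MathematicalPhysics.QuantumLattice

end
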